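import Summits.BirchSwinnertonDyer.BirchSwinnertonDyer.Theorems.PrintCf2SplitBadTwoRestrictedControlOfFourResidualsV2
import Summits.BirchSwinnertonDyer.BirchSwinnertonDyer.Theorems.PrintCf2SplitBadTwoRestrictedTopOfLocSurj
import Summits.BirchSwinnertonDyer.BirchSwinnertonDyer.Theorems.PrintCf2SplitBadTwoLineKernelOfFrame
import HarnessLib

/-!
# Crux `PrintCf2.SplitBadTwoRankOneOfFacts` (stmt-BirchSwinnertonDyer-20368), road α v10.3 — S3c assembly, TENTH CUT:
# `stub_restrictedControl_two` ⟸ [Poitou–Tate for Ш, cd₂ ≤ 2] ∧ (CT-𝔖) ∧ (LS) ∧ (R-BV)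

Cell `bsd-print-cf2`, LEAD seat `bsd-line-cf2-p1` g12 (prover-bsd-line-cf2-p1-g12-0); `--supports stmt-BirchSwinnertonDyer-20368` (helper, Theses-free).
HONEST FRAMING: proves the registered statement of S3c from DISPLAYED HYPOTHESES, two of which are the tree's NAMED (unproved, published) facts
`poitouTate_sha_tateDual` [Harari 2020 Thm. 17.13] and `fieldCdLE_two_of_numberField` [Serre, Galois Cohomology II §4.4 Prop. 13]; BSD is not proved
by any of this; no summit statement is proved by this seat. No definition, no `sorry`.

WHAT CHANGED AGAINST CUT 9 (`restrictedControl_two_of_top_surj_bv`, p671311: ⟸ (R-TOP′) ∧ (R-SURJ″) ∧ (R-BV)). Following -w5 g3's proposal (p671739,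
p671382), the two cokernel-side residuals (R-TOP′) and (R-SURJ″) are both consequences of ONE displayed statement, the level-`K` LOCAL SURJECTIVITY
**(LS)** for `W* = (E_K)[π^∞]^{(r)}` away from `v` UNDER the bottom finiteness `Finite 𝔖_{v̄}(K, W*)` (hypothesis `hLSfin`, -w4 g9's text), together with
the conjugate-summand finiteness transport **(CT-𝔖)** `Finite 𝔖_{v̄}(K, W*) → Finite 𝔖_v(K, W*′)` (hypothesis `hTr`, -w2 g10's lane) and the two named
facts (`hPT`, `hcd`): `hTop := rTop'_of_locSurj_of_finite hPT hcd hTr hLSfin` (-w5 g3 p671739 on -w4 g9 `natCard_endCoinvariants_eq_one_of_frame_of_locSurj`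
p668156: `e_Γ ≡ 0`), `hSurj := rSurj''_of_locSurj_of_finite hLSfin` (-w5 g3 p671382: `e_s ≡ −1`), `hDy := dyadicResidual_holds` (-w6 g3 p670567).
So the displayed residual content of S3c is now: (LS)-under-finiteness [-w4 g9, port of X11b level lifting to W*-families, memo TURNKEY-20368-LS-w4g9.md §2],
(CT-𝔖) [-w2 g10], (R-BV) [-w7 g2 `rBV_of_three_factor_values` ⟸ (F1)(F3)(H1′)(H2); (F2) ⟸ (H1″), -w8 g2], and the two Literature facts.
The proof body is cut 7's (the (R-TOP′) supplier carries the conclusion's `[W.IsGloballyMinimal]` binder, so cut 7 is re-run rather than called).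
`e_C := e_K + e_{v̄} + e_s − e_k − e_Γ`. DISCHARGE AGAINST THIS CUT. presearch: not applicable (assembly of tree theorems). beyond-print theorem: no.

References: [Agboola2007] §3 Prop. 3.2, §5, §6 Prop. 6.10–6.11, Prop. 8.1; [GreenbergLNM1716] §3 Lemmas 3.1–3.3, §4 Lemma 4.2; [Harari2020] Thm. 17.13;
[SerreGaloisCohomology1997] II §4.4 Prop. 13.
-/

noncomputable section

open scoped Classical

set_option linter.dupNamespace false
set_option autoImplicit false

open NumberField IsDedekindDomain Field WeierstrassCurve
open Literature.NumberTheory.EllipticCurves Literature.NumberTheory.EllipticCurves.GreenbergSelmer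
open Literature.NumberTheory.EllipticCurves.Agboola2007
open Literature.NumberTheory.EllipticCurves.IwasawaAlgebra
open Literature.NumberTheory.EllipticCurves.IwasawaDual
open Literature.NumberTheory.EllipticCurves.ResKernel
open Literature.NumberTheory.GaloisRepresentations
open Literature.NumberTheory.GaloisCohomology
open Summit.BirchSwinnertonDyer.BirchSwinnertonDyer.Theorems.PrintCf2.AdditiveAtSeven
open Summit.BirchSwinnertonDyer.BirchSwinnertonDyer.Theorems.GoldfeldGoodTwists

namespace Summit.BirchSwinnertonDyer.BirchSwinnertonDyer.Theorems.PrintCf2.RestrictedSelmerPair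

/-- **S3c `stub_restrictedControl_two` — TENTH CUT: ⟸ `poitouTate_sha_tateDual` ∧ `fieldCdLE_two_of_numberField` ∧ (CT-𝔖) ∧ (LS)-under-finiteness
∧ (R-BV)**; (R-TOP′) and (R-SURJ″) of cut 9 supplied by -w5 g3's `rTop'_of_locSurj_of_finite` / `rSurj''_of_locSurj_of_finite`, (R-DYADIC) by -w6 g3's
`dyadicResidual_holds`, (C1), (R-KER), (R-SEVEN) as in cuts 5–7. CONDITIONAL on the displayed hypotheses (two of them named Literature facts).
[cite: Agboola2007, §3 Prop. 3.2, §6 Prop. 6.10–6.11, §8 Prop. 8.1] [cite: GreenbergLNM1716, §3 Lemmas 3.1–3.3, §4 Lemma 4.2] [cite: Harari2020, Thm. 17.13] -/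
theorem restrictedControl_two_of_locSurj_bv
    (hPT : ∀ (K : Type) [Field K] [NumberField K], poitouTate_sha_tateDual K) (hcd : fieldCdLE_two_of_numberField)
    (hTr : ∀ (d : ℤ), d ≠ 0 → Squarefree d → d % 4 ≠ 1 →
      ∀ (W : WeierstrassCurve ℚ) [W.IsElliptic] (C : VariableChange ℚ), C • W = cm7.quadraticTwist (d : ℚ) →
      ∀ (K : Type) [Field K] [NumberField K], IsImaginaryQuadratic K →
      ∀ (v vbar : HeightOneSpectrum (𝓞 K)),
        ((2 : ℕ) : 𝓞 K) ∈ v.asIdeal → ((2 : ℕ) : 𝓞 K) ∈ vbar.asIdeal → vbar ≠ v →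
      ∀ (π : (W.baseChange K).endRing), (π : AddMonoid.End (W.baseChange K).geomPoints) * π = π - 2 →
      ∀ (r : ℤ_[2]), r * r = r - 2 →
      Finite (restrictedSelmerBase ↥((W.baseChange K).endEigenPrimaryTorsion 2 π r) 2 vbar) →
      Finite (restrictedSelmerBase ↥((W.baseChange K).endEigenPrimaryTorsion 2 π (1 - r)) 2 v))
    (hLSfin : ∀ (d : ℤ), d ≠ 0 → Squarefree d → d % 4 ≠ 1 →
      ∀ (W : WeierstrassCurve ℚ) [W.IsElliptic] (C : VariableChange ℚ), C • W = cm7.quadraticTwist (d : ℚ) →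
      ∀ (K : Type) [Field K] [NumberField K], IsImaginaryQuadratic K →
      ∀ (v vbar : HeightOneSpectrum (𝓞 K)),
        ((2 : ℕ) : 𝓞 K) ∈ v.asIdeal → ((2 : ℕ) : 𝓞 K) ∈ vbar.asIdeal → vbar ≠ v →
      ∀ (π : (W.baseChange K).endRing), (π : AddMonoid.End (W.baseChange K).geomPoints) * π = π - 2 →
      ∀ (r : ℤ_[2]), r * r = r - 2 →
      Finite (restrictedSelmerBase ↥((W.baseChange K).endEigenPrimaryTorsion 2 π r) 2 vbar) →
      ∀ (S : Finset (HeightOneSpectrum (𝓞 K))), (∀ w ∈ S, ((2 : ℕ) : 𝓞 K) ∉ w.asIdeal ∨ w = vbar) →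
      ∀ τ : (w : HeightOneSpectrum (𝓞 K)) → subgroupH1 (decomp (K := K) w) ↥((W.baseChange K).endEigenPrimaryTorsion 2 π r),
      ∃ g : discreteH1 (absoluteGaloisGroup K) ↥((W.baseChange K).endEigenPrimaryTorsion 2 π r),
        (∀ w ∈ S, ResKernel.resSubgroup (decomp (K := K) w) ↥((W.baseChange K).endEigenPrimaryTorsion 2 π r) g = τ w) ∧
        (∀ w : HeightOneSpectrum (𝓞 K), w ∉ S → ((2 : ℕ) : 𝓞 K) ∉ w.asIdeal →
          ResKernel.resSubgroup (decomp (K := K) w) ↥((W.baseChange K).endEigenPrimaryTorsion 2 π r) g = 0))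
    (hBV : ∃ eK : ℤ → ℤ → ℤ, ∀ (d : ℤ), d ≠ 0 → Squarefree d → d % 4 ≠ 1 →
      ∀ (W : WeierstrassCurve ℚ) [W.IsElliptic] [W.IsGloballyMinimal] (C : VariableChange ℚ),
        C • W = cm7.quadraticTwist (d : ℚ) → W.analyticRank = 1 →
      ∀ (K : Type) [Field K] [NumberField K], IsImaginaryQuadratic K →
      ∀ (v vbar : HeightOneSpectrum (𝓞 K)),
        ((2 : ℕ) : 𝓞 K) ∈ v.asIdeal → ((2 : ℕ) : 𝓞 K) ∈ vbar.asIdeal → vbar ≠ v →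
      ∀ (π : (W.baseChange K).endRing), (π : AddMonoid.End (W.baseChange K).geomPoints) * π = π - 2 →
      ∀ (r : ℤ_[2]), r * r = r - 2 →
        (∀ τ ∈ GreenbergSelmer.inertia v, ∀ x : ↥((W.baseChange K).endEigenPrimaryTorsion 2 π r), τ • x = x ∨ τ • x = -x) →
      ∀ (P : W.toAffine.Point) (c₀ : ℕ) (ℓ : ℤ),
        ¬ IsOfFinAddOrder P →
        (∀ R : W.toAffine.Point, ∃ (k : ℤ) (T : W.toAffine.Point), IsOfFinAddOrder T ∧ R = k • P + T) →
        c₀ ≠ 0 → (W.baseChange ℚ_[2]).IsInReductionKernel (c₀ • W.toPadicPoint 2 P) →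
        ‖(W.baseChange ℚ_[2]).padicLogPoint (c₀ • W.toPadicPoint 2 P) / (c₀ : ℚ_[2])‖ = (2 : ℝ) ^ (-ℓ) →
      Finite (restrictedSelmerBase ↥((W.baseChange K).endEigenPrimaryTorsion 2 π r) 2 vbar) →
        (padicValNat 2 (Nat.card (restrictedSelmerBase ↥((W.baseChange K).endEigenPrimaryTorsion 2 π r) 2 vbar)) : ℤ) =
          (padicValNat 2 (Nat.card (AddCommGroup.primaryComponent W.sha 2)) : ℤ) + 2 * ℓ + eK (d % 2) ((d / (2 - d % 2)) % 8)) :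
    -- CONCLUSION: S3c `stub_restrictedControl_two`, v9 = v10.3 VERBATIM
    -- CONCLUSION: S3c `stub_restrictedControl_two`, v9 = v10.3 VERBATIM
    ∃ eC : ℤ → ℤ → ℤ,
    ∀ (d : ℤ), d ≠ 0 → Squarefree d → d % 4 ≠ 1 →
    ∀ (W : WeierstrassCurve ℚ) [W.IsElliptic] [W.IsGloballyMinimal] (C : VariableChange ℚ),
      C • W = cm7.quadraticTwist (d : ℚ) → W.analyticRank = 1 →
    ∀ (K : Type) [Field K] [NumberField K], IsImaginaryQuadratic K →
    ∀ (v vbar : HeightOneSpectrum (𝓞 K)),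
      ((2 : ℕ) : 𝓞 K) ∈ v.asIdeal → ((2 : ℕ) : 𝓞 K) ∈ vbar.asIdeal → vbar ≠ v →
    ∀ (π : (W.baseChange K).endRing), (π : AddMonoid.End (W.baseChange K).geomPoints) * π = π - 2 →
    ∀ (r : ℤ_[2]), r * r = r - 2 →
      (∀ τ ∈ GreenbergSelmer.inertia v, ∀ x : ↥((W.baseChange K).endEigenPrimaryTorsion 2 π r), τ • x = x ∨ τ • x = -x) →
    ∀ (κ' : ZpExtension K 2), κ'.IsUnramifiedOutside vbar → ∀ (γ' : absoluteGaloisGroup K), κ'.IsTopGenerator γ' →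
    ∀ (D : Agboola2007.RestrictedDualData κ' ↥((W.baseChange K).endEigenPrimaryTorsion 2 π r) vbar γ') (n : ℕ),
      Module.Finite (IwasawaAlgebra 2) D.X → D.HasCharValuationAt n →
    ∀ (P : W.toAffine.Point) (c₀ : ℕ) (ℓ : ℤ),
      ¬ IsOfFinAddOrder P →
      (∀ R : W.toAffine.Point, ∃ (k : ℤ) (T : W.toAffine.Point), IsOfFinAddOrder T ∧ R = k • P + T) →
      c₀ ≠ 0 → (W.baseChange ℚ_[2]).IsInReductionKernel (c₀ • W.toPadicPoint 2 P) →
      ‖(W.baseChange ℚ_[2]).padicLogPoint (c₀ • W.toPadicPoint 2 P) / (c₀ : ℚ_[2])‖ = (2 : ℝ) ^ (-ℓ) →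
      (n : ℤ) = ((padicValNat 2 (Nat.card (AddCommGroup.primaryComponent W.sha 2)) : ℤ)
            + (padicValNat 2 W.tamagawaProduct : ℤ)
            - 2 * (padicValNat 2 W.torsionOrder : ℤ) + 2 * ℓ) + eC (d % 2) ((d / (2 - d % 2)) % 8) := by
  haveI : Fact (Nat.Prime 2) := ⟨Nat.prime_two⟩
  obtain ⟨ek, hek⟩ := kerResidual_holds
  obtain ⟨eΓ, heΓ⟩ := rTop'_of_locSurj_of_finite hPT hcd hTr hLSfin
  obtain ⟨ev, hev⟩ := dyadicResidual_holds
  obtain ⟨eK, heK⟩ := hBV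
  obtain ⟨es, hes⟩ := rSurj''_of_locSurj_of_finite hLSfin
  refine ⟨fun a b ↦ eK a b + ev a b + es a b - ek a b - eΓ a b, ?_⟩
  intro d hd0 hsq hd4 W _ _ C hC hrk K _ _ hK v vbar hv hvbar hne π hrel r hr hpin κ' hκ' γ' hγ' D n hDf hDn
    P c₀ ℓ hP hgen hc₀ hker hlog
  haveI : (W.baseChange K).IsElliptic := inferInstanceAs ((W.map (algebraMap ℚ K)).IsElliptic)
  haveI := hDf
  -- 1. the four-index identity with all finiteness
  obtain ⟨hfinI, hfinC, hfinB, hfinK, hid⟩ :=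
    hasCharValuationAt_control_identity_endEigenPrimaryTorsion (W.baseChange K) 2 π r κ' hγ' vbar D hDn
  -- 2./3. kernel and top terms as class functions
  have hkerZ := hek d hd0 hsq hd4 W C hC K hK v vbar hv hvbar hne π hrel r hr hpin κ' hκ' γ' hγ'
  have htopZ := heΓ d hd0 hsq hd4 W C hC K hK v vbar hv hvbar hne π hrel r hr hpin κ' hκ' γ' hγ' D n hDf hDn
  -- 4. places `T`, Tamagawa dictionary, torsion
  obtain ⟨T, hT⟩ := exists_finset_seven_mul (K := K) hd0
  have hC1T : ∀ w ∈ T, ¬ decomp w ≤ κ'.kerSubgroup := fun w hw ↦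
    LineDecomposition.decomp_not_le_kerSubgroup_of_isUnramifiedOutside hK hv hvbar hne κ' hκ'
      (fun h ↦ ((hT w).mp hw).1 (h ▸ hvbar))
  have hTam : (∑ w ∈ T, padicValNat 2 (Nat.card (resOfLe ↥((W.baseChange K).endEigenPrimaryTorsion 2 π r) (inf_le_inf_right (decomp w) (le_top : κ'.kerSubgroup ≤ ⊤))).ker)) + 2 =
      padicValNat 2 W.tamagawaProduct ∧ W.torsionOrder = 2 := by
    by_cases h7 : (7 : ℤ) ∣ d
    · obtain ⟨htors, hlaw⟩ := TamagawaPlaces.rSeven_cut4 d hsq hd4 h7 W C hC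
      exact ⟨hlaw K hK vbar hvbar π hrel r hr κ' hκ' T hT hC1T, htors⟩
    · exact ⟨sum_padicValNat_localKer_top_of_frame_add_two_eq hsq hd4 h7 W C hC hK vbar hvbar π hrel hr κ' hκ' T hT hC1T,
        torsionOrder_eq_two_of_smul_eq_cm7_quadraticTwist hsq hd4 h7 W C hC⟩
  obtain ⟨hTamEq, htors⟩ := hTam
  -- 5. dyadic value, 6. exact cokernel and bottom value
  have hdy := hev d hd0 hsq hd4 W C hC K hK v vbar hv hvbar hne π hrel r hr hpin κ' hκ'
  have hsurj := hes d hd0 hsq hd4 W C hC hrk K hK v vbar hv hvbar hne π hrel r hr hpin κ' hκ' γ' hγ' hfinI T hT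
  have hbv := heK d hd0 hsq hd4 W C hC hrk K hK v vbar hv hvbar hne π hrel r hr hpin P c₀ ℓ hP hgen hc₀ hker hlog hfinB
  -- 7. arithmetic
  have htors2 : (padicValNat 2 W.torsionOrder : ℤ) = 1 := by
    rw [htors]; simp
  have hidZ := congrArg (fun m : ℕ ↦ (m : ℤ)) hid
  have hTamZ := congrArg (fun m : ℕ ↦ (m : ℤ)) hTamEq
  dsimp only at hidZ hTamZ ⊢
  push_cast at hidZ hTamZ hsurj hbv hdy hkerZ htopZ htors2 ⊢
  linarith

end Summit.BirchSwinnertonDyer.BirchSwinnertonDyer.Theorems.PrintCf2.RestrictedSelmerPair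

end
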